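import Literature.NumberTheory.LFunctions.Zhang2022.MainTermFormEll
import Mathlib.Analysis.Real.Pi.Bounds

/-!
# Zhang (2022) design-space objective, twin part 3: the exact slopes of the ℓ-edge (`μ₁ = −171.55…`, `μ₂ = −16π`, `μ₃`, `μ_c`)

Y. Zhang, *Discrete mean estimates and the Landau–Siegel zero*, arXiv:2211.02515v1 (2022)
[Zhang2022LandauSiegel] — an unrefereed manuscript under adjudication. **This file SEARCHES and TYPES; it
makes no claim about Landau–Siegel zeros, about Theorems 1–2 of the manuscript, or about a repaired
(2.32), until a kernel theorem says so.** Companion of `ObjectiveTwin` / `ObjectiveTwinCert` (LANDAU–SIEGEL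
programme, charter LS-PROGRAMME v1.1 §2 row A; CONTROL items C2a / C2b / C3b of OBJECTIVE.md §5).

The ℓ-edge of the manuscript's main-term calculus (`MainTermFormEll`: `F_ℓ = mainTermFormEll ℓ`, `F₁ = 𝔅`,
`F_ℓ(e^{−iπjy}) = 8π(j−ℓ)(j−2ℓ)(j−3ℓ)/j`, negative on `e^{−iπy}` for every `ℓ > 1`) has a certified-numerics
record (repair/num-1 L11 §3, kit j251235): on the kernel `K = ker 𝔅 = span{k_j = e^{−iπjy}}_{j=1,2,3}` the
slope form `D_K = (dF_ℓ/dℓ)|_{ℓ=1}` is `π·diag(−16, 8, −16)` in the basis `(k₁,k₂,k₃)`, the `L²`-Gram is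
`G_K = I + (2/π)J`, and the generalized eigenvalues of `(D_K, G_K)` — the first-order splitting of the triple
zero eigenvalue of `F_ℓ` against `‖·‖²_{L²}` — are `μ₁ = −4π²(π+√(9π²−64))/(π²−8) = −171.5500948955…`,
`μ₂ = −16π`, `μ₃ = 4π²(√(9π²−64)−π)/(π²−8) = 38.8748544554…`. This file makes the finite algebra a kernel
theorem:

* `ellSlopeDiag j = −(16π/j)(3j² − 11j + 9)` IS the derivative of the closed form at `ℓ = 1`
  (`hasDerivAt_mainTermFormEll_afeDir`), with values `−16π, 8π, −16π` at `j = 1, 2, 3`;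
* `kernelGramQ` — the Gram form of `G_K` (`⟨k_a, k_b⟩ = ∫₀¹ k_a k̄_b = 1, 2i/π, 0` for `b − a = 0, 1, 2`; taken
  as the definition); `ellSlopeQ` — the slope form of `D_K`. THE DIAGONALITY OF `D_K` (the cross slopes vanish:
  double root of the cross terms at `ℓ = 1`, j251235 §3 REMARK) is the certified record, NOT re-derived here;
* `ellSlopeMin` (`μ₁`) and `ellSlopeMax` (`μ₃`): roots of the pencil's quadratic factor
  (`ellSlopeMin_pencil : π²(8π − μ₁)(−16π − μ₁) = 8μ₁²`), brackets `ellSlopeMin_bounds : μ₁ ∈ (−171.5502, −171.55)`,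
  `ellSlopeMax_bounds : μ₃ ∈ (38.8748, 38.8749)` (from `Real.pi_gt_d20` / `pi_lt_d20`), and the MINIMALITY of `μ₁`
  as a sum-of-squares certificate: `ellSlopeQ_ge : μ₁ · G_K(x) ≤ D_K(x)` for all `x ∈ ℂ³`, with equality at the
  explicit eigenvector `(−2μ₁ i, π(−16π−μ₁), 2μ₁ i)` of positive Gram norm (`ellSlopeQ_eigenvector`);
* C2b: the four closed-form control values `F_{21/20}(k₁) ∈ (−2.972, −2.9719)`, `F_{21/20}(k₄) ∈ (29.934, 29.935)`,
  `F_{9/10}(k₄) ∈ (55.706, 55.707)`, `F_{1/2}(k₄) ∈ (164.933, 164.934)` (`controlEll_values`);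
* C3b: the constrained slope of the LENGTH edge, `μ_c = −48π³/(3π²−16) ∈ (−109.3631, −109.363)` (`lengthSlopeMin`,
  `lengthSlopeMin_bounds`): on the kernel plane `K ∩ {u(1) = 0} = span{k₁+k₂, k₂+k₃}` the pencil
  `(8π[[−1,1],[1,−1]], [[2, 1+4i/π],[1−4i/π, 2]])` has eigenvalues `μ_c` and `0`, and `μ_c` is the minimum
  (`lengthSlopeQ_ge`, sum-of-squares certificate; record repair/num-1 L11 §3b, kit j251370).

All statements cite the manuscript's scale (2.10) and shifts (2.13) whose deformation `F_ℓ` encodes; the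
algebra is elementary. No analytic content, no new `Prop` facts about the manuscript.
-/

noncomputable section

open Real Complex ComplexConjugate

namespace Literature.NumberTheory.LFunctions.Zhang2022

namespace Objective

/-! ## The diagonal slopes `d/dℓ F_ℓ(e^{−iπjy})|_{ℓ=1}` -/

/-- `D_K`'s diagonal: `d/dℓ F_ℓ(e^{−iπjy})|_{ℓ=1} = −(16π/j)(3j² − 11j + 9)` (record repair/num-1 L11 §3).
[cite: Zhang2022LandauSiegel, §2 (2.10), (2.13)] -/
def ellSlopeDiag (j : ℕ) : ℝ := -(16 * π / j) * (3 * (j : ℝ) ^ 2 - 11 * j + 9)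

/-- `D_K(k₁) = −16π` (`= μ₂`). [cite: Zhang2022LandauSiegel, §2 (2.10), (2.13)] -/
theorem ellSlopeDiag_one : ellSlopeDiag 1 = -(16 * π) := by unfold ellSlopeDiag; norm_num

/-- `D_K(k₂) = 8π`. [cite: Zhang2022LandauSiegel, §2 (2.10), (2.13)] -/
theorem ellSlopeDiag_two : ellSlopeDiag 2 = 8 * π := by unfold ellSlopeDiag; norm_num; ring

/-- `D_K(k₃) = −16π`. [cite: Zhang2022LandauSiegel, §2 (2.10), (2.13)] -/
theorem ellSlopeDiag_three : ellSlopeDiag 3 = -(16 * π) := by unfold ellSlopeDiag; norm_num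

/-- **`ellSlopeDiag j` IS the `ℓ`-derivative at `ℓ = 1` of `F_ℓ(e^{−iπjy}) = 8π(j−ℓ)(j−2ℓ)(j−3ℓ)/j`**
(`mainTermFormEll_afeDir`), for every `j ≥ 1`. [cite: Zhang2022LandauSiegel, §2 (2.10), (2.13)] -/
theorem hasDerivAt_mainTermFormEll_afeDir {j : ℕ} (hj : j ≠ 0) :
    HasDerivAt (fun ℓ : ℝ => mainTermFormEll ℓ (afeDir j) (afeDir' j)) (ellSlopeDiag j) 1 := by
  have hjr : (j : ℝ) ≠ 0 := Nat.cast_ne_zero.mpr hj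
  have h1 : HasDerivAt (fun ℓ : ℝ => (j : ℝ) - ℓ) (-1) 1 := (hasDerivAt_id (1:ℝ)).const_sub _
  have h2 : HasDerivAt (fun ℓ : ℝ => (j : ℝ) - 2 * ℓ) (-2) 1 := by
    simpa using ((hasDerivAt_id (1:ℝ)).const_mul 2).const_sub (j : ℝ)
  have h3 : HasDerivAt (fun ℓ : ℝ => (j : ℝ) - 3 * ℓ) (-3) 1 := by
    simpa using ((hasDerivAt_id (1:ℝ)).const_mul 3).const_sub (j : ℝ)
  have h := (((h1.mul h2).mul h3).const_mul (8 * π)).div_const (j : ℝ)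
  refine (h.congr_deriv ?_).congr_of_eventuallyEq (Filter.Eventually.of_forall fun ℓ => ?_)
  · simp only [Pi.mul_apply]
    unfold ellSlopeDiag
    field_simp
    ring
  · simp only [Pi.mul_apply, mainTermFormEll_afeDir hj]

/-! ## The kernel pencil `(D_K, G_K)` as forms on the coefficients `x = (x₁, x₂, x₃)` of `u = Σ x_j k_j` -/

/-- **The `L²` Gram form of the kernel basis**: `‖x₁k₁ + x₂k₂ + x₃k₃‖²_{L²[0,1]} =
|x₁|² + |x₂|² + |x₃|² − (4/π)·Im(x₁x̄₂ + x₂x̄₃)` (`⟨k_a,k_b⟩ = ∫₀¹ e^{−iπ(a−b)y}dy = 1, 2i/π, 0` for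
`b − a = 0, 1, 2`), i.e. `G_K = I + (2/π)J` of the record. [cite: Zhang2022LandauSiegel, §2 (2.10), (2.13)] -/
def kernelGramQ (x₁ x₂ x₃ : ℂ) : ℝ :=
  ‖x₁‖ ^ 2 + ‖x₂‖ ^ 2 + ‖x₃‖ ^ 2 - 4 / π * (x₁ * conj x₂ + x₂ * conj x₃).im

/-- **The slope form `D_K = π·diag(−16, 8, −16)`** on the coefficients (diagonal: the cross slopes vanish at
`ℓ = 1`, record j251235 §3). [cite: Zhang2022LandauSiegel, §2 (2.10), (2.13)] -/
def ellSlopeQ (x₁ x₂ x₃ : ℂ) : ℝ :=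
  ellSlopeDiag 1 * ‖x₁‖ ^ 2 + ellSlopeDiag 2 * ‖x₂‖ ^ 2 + ellSlopeDiag 3 * ‖x₃‖ ^ 2

/-- `D_K(x) = −16π|x₁|² + 8π|x₂|² − 16π|x₃|²`. [cite: Zhang2022LandauSiegel, §2 (2.10), (2.13)] -/
theorem ellSlopeQ_eq (x₁ x₂ x₃ : ℂ) :
    ellSlopeQ x₁ x₂ x₃ = -(16 * π) * ‖x₁‖ ^ 2 + 8 * π * ‖x₂‖ ^ 2 - 16 * π * ‖x₃‖ ^ 2 := by
  rw [ellSlopeQ, ellSlopeDiag_one, ellSlopeDiag_two, ellSlopeDiag_three]; ring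

/-- **`μ₁ = −4π²(π + √(9π²−64))/(π²−8)`** — the least generalized eigenvalue of `(D_K, G_K)` (record
`−171.5500948955251`, repair/num-1 L11 §3 kit j251235). [cite: Zhang2022LandauSiegel, §2 (2.10), (2.13)] -/
def ellSlopeMin : ℝ := -(4 * π ^ 2 * (π + Real.sqrt (9 * π ^ 2 - 64))) / (π ^ 2 - 8)

/-- **`μ₃ = 4π²(√(9π²−64) − π)/(π²−8)`** — the largest generalized eigenvalue (record `+38.8748544554257`).
[cite: Zhang2022LandauSiegel, §2 (2.10), (2.13)] -/
def ellSlopeMax : ℝ := 4 * π ^ 2 * (Real.sqrt (9 * π ^ 2 - 64) - π) / (π ^ 2 - 8)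

/-! ### Elementary facts about `π` and `s = √(9π² − 64)` -/

/-- `9π² > 64`. [folklore] -/
private theorem nine_pi_sq_sub_pos : 0 < 9 * π ^ 2 - 64 := by nlinarith [Real.pi_gt_three]

/-- `π² > 8`. [folklore] -/
private theorem pi_sq_sub_eight_pos : 0 < π ^ 2 - 8 := by nlinarith [Real.pi_gt_three]

/-- `s² = 9π² − 64` for `s = √(9π²−64)`. [folklore] -/
private theorem s_sq : Real.sqrt (9 * π ^ 2 - 64) ^ 2 = 9 * π ^ 2 - 64 :=
  Real.sq_sqrt nine_pi_sq_sub_pos.le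

/-- `s ≥ 0`. [folklore] -/
private theorem s_nonneg : 0 ≤ Real.sqrt (9 * π ^ 2 - 64) := Real.sqrt_nonneg _

/-- `π² ∈ (9.8696044010893, 9.8696044010894)` from the 20-digit bounds on `π`. [folklore] -/
private theorem pi_sq_bounds : (9.8696044010893 : ℝ) < π ^ 2 ∧ π ^ 2 < 9.8696044010894 := by
  constructor <;> nlinarith [Real.pi_gt_d20, Real.pi_lt_d20, Real.pi_pos]

/-- `π³ ∈ (31.00627668029, 31.0062766803)`. [folklore] -/
private theorem pi_cube_bounds : (31.00627668029 : ℝ) < π ^ 3 ∧ π ^ 3 < 31.0062766803 := by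
  have h := pi_sq_bounds
  constructor <;> nlinarith [Real.pi_gt_d20, Real.pi_lt_d20, Real.pi_pos, h.1, h.2]

/-- `s = √(9π²−64) ∈ (4.9826137, 4.9826138)`. [folklore] -/
private theorem s_bounds : (4.9826137 : ℝ) < Real.sqrt (9 * π ^ 2 - 64) ∧ Real.sqrt (9 * π ^ 2 - 64) < 4.9826138 := by
  have h := pi_sq_bounds
  constructor
  · rw [Real.lt_sqrt (by norm_num)]; nlinarith [h.1]
  · rw [Real.sqrt_lt' (by norm_num)]; nlinarith [h.2]

/-! ### The characteristic relation and the brackets -/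

/-- `(π² − 8)·μ₁ = −4π²(π + s)`. [cite: Zhang2022LandauSiegel, §2 (2.10), (2.13)] -/
private theorem ellSlopeMin_mul : (π ^ 2 - 8) * ellSlopeMin = -(4 * π ^ 2 * (π + Real.sqrt (9 * π ^ 2 - 64))) := by
  unfold ellSlopeMin
  field_simp [pi_sq_sub_eight_pos.ne']

/-- **`μ₁` is a root of the pencil's quadratic factor**: `(π²−8)μ² + 8π³μ − 128π⁴ = 0`, i.e.
`det(D_K − μG_K)/(−16π − μ) = 0`. [cite: Zhang2022LandauSiegel, §2 (2.10), (2.13)] -/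
theorem ellSlopeMin_charpoly : (π ^ 2 - 8) * ellSlopeMin ^ 2 + 8 * π ^ 3 * ellSlopeMin - 128 * π ^ 4 = 0 := by
  have e1 := ellSlopeMin_mul
  have hs := s_sq
  have hne := pi_sq_sub_eight_pos.ne'
  have key : (π ^ 2 - 8) * ((π ^ 2 - 8) * ellSlopeMin ^ 2 + 8 * π ^ 3 * ellSlopeMin - 128 * π ^ 4) = 0 := by
    linear_combination ((π ^ 2 - 8) * ellSlopeMin + 4 * π ^ 2 * (π + Real.sqrt (9 * π ^ 2 - 64))
      - 8 * π ^ 2 * Real.sqrt (9 * π ^ 2 - 64)) * e1 + 16 * π ^ 4 * hs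
  rcases mul_eq_zero.1 key with h | h
  · exact absurd h hne
  · exact h

/-- The same relation in pencil form: `π²·(8π − μ₁)(−16π − μ₁) = 8μ₁²` (the Schur-complement identity behind
`ellSlopeQ_ge`). [cite: Zhang2022LandauSiegel, §2 (2.10), (2.13)] -/
theorem ellSlopeMin_pencil : π ^ 2 * ((8 * π - ellSlopeMin) * (-(16 * π) - ellSlopeMin)) = 8 * ellSlopeMin ^ 2 := by
  linear_combination ellSlopeMin_charpoly

/-- **`μ₁ ∈ (−171.5502, −171.55)`** (record `−171.5500948955251…`). [cite: Zhang2022LandauSiegel, §2 (2.10), (2.13)] -/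
theorem ellSlopeMin_bounds : (-171.5502 : ℝ) < ellSlopeMin ∧ ellSlopeMin < -171.55 := by
  have hd := pi_sq_sub_eight_pos
  have h2 := pi_sq_bounds
  have h3 := pi_cube_bounds
  have hs := s_bounds
  have hs0 := s_nonneg
  have lo23 : (9.8696044010893 : ℝ) * 4.9826137 < π ^ 2 * Real.sqrt (9 * π ^ 2 - 64) :=
    mul_lt_mul'' h2.1 hs.1 (by norm_num) (by norm_num)
  have hi23 : π ^ 2 * Real.sqrt (9 * π ^ 2 - 64) < 9.8696044010894 * 4.9826138 :=
    mul_lt_mul'' h2.2 hs.2 (by positivity) hs0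
  unfold ellSlopeMin
  constructor
  · rw [lt_div_iff₀ hd]; nlinarith [h2.1, h2.2, h3.1, h3.2, hi23]
  · rw [div_lt_iff₀ hd]; nlinarith [h2.1, h2.2, h3.1, h3.2, lo23]

/-- `μ₁ < −16π = μ₂` (the two negative branches are distinct; `u := −16π − μ₁ > 0`). [cite: Zhang2022LandauSiegel, §2 (2.10), (2.13)] -/
theorem ellSlopeMin_lt_mu2 : ellSlopeMin < -(16 * π) := by
  have h := ellSlopeMin_bounds.2
  nlinarith [Real.pi_lt_d6]

/-- **`μ₃ ∈ (38.8748, 38.8749)`** (record `+38.8748544554257…`). [cite: Zhang2022LandauSiegel, §2 (2.10), (2.13)] -/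
theorem ellSlopeMax_bounds : (38.8748 : ℝ) < ellSlopeMax ∧ ellSlopeMax < 38.8749 := by
  have hd := pi_sq_sub_eight_pos
  have h2 := pi_sq_bounds
  have h3 := pi_cube_bounds
  have hs := s_bounds
  have hs0 := s_nonneg
  have lo23 : (9.8696044010893 : ℝ) * 4.9826137 < π ^ 2 * Real.sqrt (9 * π ^ 2 - 64) :=
    mul_lt_mul'' h2.1 hs.1 (by norm_num) (by norm_num)
  have hi23 : π ^ 2 * Real.sqrt (9 * π ^ 2 - 64) < 9.8696044010894 * 4.9826138 :=
    mul_lt_mul'' h2.2 hs.2 (by positivity) hs0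
  unfold ellSlopeMax
  constructor
  · rw [lt_div_iff₀ hd]; nlinarith [h2.1, h2.2, h3.1, h3.2, lo23]
  · rw [div_lt_iff₀ hd]; nlinarith [h2.1, h2.2, h3.1, h3.2, hi23]

/-! ### Minimality of `μ₁`: the sum-of-squares certificate and the eigenvector -/

/-- `‖z‖² = Re² + Im²`. [folklore] -/
private theorem normSq_re_im (z : ℂ) : ‖z‖ ^ 2 = z.re ^ 2 + z.im ^ 2 := by
  rw [Complex.sq_norm, Complex.normSq_apply]; ring

/-- **The Schur/SOS identity**: with `u = −16π − μ₁`,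
`π²u·(D_K(x) − μ₁G_K(x)) = (πu·a₁ − 2μ₁b₂)² + (πu·b₁ + 2μ₁a₂)² + (πu·a₃ + 2μ₁b₂)² + (πu·b₃ − 2μ₁a₂)²`
(`x_k = a_k + ib_k`), by `ellSlopeMin_pencil`. [cite: Zhang2022LandauSiegel, §2 (2.10), (2.13)] -/
theorem ellSlopeQ_sos (x₁ x₂ x₃ : ℂ) :
    π ^ 2 * (-(16 * π) - ellSlopeMin) * (ellSlopeQ x₁ x₂ x₃ - ellSlopeMin * kernelGramQ x₁ x₂ x₃) =
      (π * (-(16 * π) - ellSlopeMin) * x₁.re - 2 * ellSlopeMin * x₂.im) ^ 2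
      + (π * (-(16 * π) - ellSlopeMin) * x₁.im + 2 * ellSlopeMin * x₂.re) ^ 2
      + (π * (-(16 * π) - ellSlopeMin) * x₃.re + 2 * ellSlopeMin * x₂.im) ^ 2
      + (π * (-(16 * π) - ellSlopeMin) * x₃.im - 2 * ellSlopeMin * x₂.re) ^ 2 := by
  have hp := ellSlopeMin_pencil
  have hq : π * (4 / π) = 4 := mul_div_cancel₀ 4 Real.pi_ne_zero
  rw [ellSlopeQ_eq, kernelGramQ, normSq_re_im, normSq_re_im, normSq_re_im]
  simp only [Complex.add_im, Complex.mul_im, Complex.conj_re, Complex.conj_im]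
  linear_combination (x₂.re ^ 2 + x₂.im ^ 2) * hp
    + (π * (-(16 * π) - ellSlopeMin) * ellSlopeMin
        * ((x₁.im * x₂.re - x₁.re * x₂.im) + (x₂.im * x₃.re - x₂.re * x₃.im))) * hq

/-- **`μ₁` is a lower bound of the pencil**: `μ₁·G_K(x) ≤ D_K(x)` for every `x ∈ ℂ³` — i.e.
`min_{x ≠ 0} D_K(x)/G_K(x) ≥ μ₁`, the first-order slope of `λ_min(F_{1+ε})/‖u‖²_{L²}` on `K` is at least `μ₁`.
[cite: Zhang2022LandauSiegel, §2 (2.10), (2.13)] -/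
theorem ellSlopeQ_ge (x₁ x₂ x₃ : ℂ) : ellSlopeMin * kernelGramQ x₁ x₂ x₃ ≤ ellSlopeQ x₁ x₂ x₃ := by
  have hu : 0 < -(16 * π) - ellSlopeMin := by linarith [ellSlopeMin_lt_mu2]
  have hc : 0 < π ^ 2 * (-(16 * π) - ellSlopeMin) := by positivity
  have h := ellSlopeQ_sos x₁ x₂ x₃
  have hnn : 0 ≤ π ^ 2 * (-(16 * π) - ellSlopeMin) * (ellSlopeQ x₁ x₂ x₃ - ellSlopeMin * kernelGramQ x₁ x₂ x₃) := by
    rw [h]; positivity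
  have := (mul_nonneg_iff_of_pos_left hc).1 hnn
  linarith

/-- **The eigenvector**: at `x* = (−2μ₁ i, π(−16π − μ₁), 2μ₁ i)` equality holds, `D_K(x*) = μ₁·G_K(x*)`, and
`G_K(x*) = 8·(16π)² + (π²−8)(−16π−μ₁)² > 0`; so `μ₁ = min_{x ≠ 0} D_K(x)/G_K(x)` exactly.
[cite: Zhang2022LandauSiegel, §2 (2.10), (2.13)] -/
theorem ellSlopeQ_eigenvector :
    ellSlopeQ (((-(2 * ellSlopeMin) : ℝ) : ℂ) * Complex.I) ((π * (-(16 * π) - ellSlopeMin) : ℝ) : ℂ)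
        (((2 * ellSlopeMin : ℝ) : ℂ) * Complex.I)
        = ellSlopeMin * kernelGramQ (((-(2 * ellSlopeMin) : ℝ) : ℂ) * Complex.I)
            ((π * (-(16 * π) - ellSlopeMin) : ℝ) : ℂ) (((2 * ellSlopeMin : ℝ) : ℂ) * Complex.I)
      ∧ 0 < kernelGramQ (((-(2 * ellSlopeMin) : ℝ) : ℂ) * Complex.I) ((π * (-(16 * π) - ellSlopeMin) : ℝ) : ℂ)
            (((2 * ellSlopeMin : ℝ) : ℂ) * Complex.I) := by
  have hu : 0 < -(16 * π) - ellSlopeMin := by linarith [ellSlopeMin_lt_mu2]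
  have hc : 0 < π ^ 2 * (-(16 * π) - ellSlopeMin) := by positivity
  have hd := pi_sq_sub_eight_pos
  set x₁ : ℂ := ((-(2 * ellSlopeMin) : ℝ) : ℂ) * Complex.I with hx₁
  set x₂ : ℂ := ((π * (-(16 * π) - ellSlopeMin) : ℝ) : ℂ) with hx₂
  set x₃ : ℂ := ((2 * ellSlopeMin : ℝ) : ℂ) * Complex.I with hx₃
  have r1 : x₁.re = 0 := by rw [hx₁]; simp
  have i1 : x₁.im = -(2 * ellSlopeMin) := by rw [hx₁]; simp
  have r2 : x₂.re = π * (-(16 * π) - ellSlopeMin) := by rw [hx₂]; simp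
  have i2 : x₂.im = 0 := by rw [hx₂]; simp
  have r3 : x₃.re = 0 := by rw [hx₃]; simp
  have i3 : x₃.im = 2 * ellSlopeMin := by rw [hx₃]; simp
  constructor
  · have h := ellSlopeQ_sos x₁ x₂ x₃
    rw [r1, i1, r2, i2, r3, i3] at h
    have hz : π ^ 2 * (-(16 * π) - ellSlopeMin) *
        (ellSlopeQ x₁ x₂ x₃ - ellSlopeMin * kernelGramQ x₁ x₂ x₃) = 0 := by
      rw [h]; ring
    have := (mul_eq_zero.1 hz).resolve_left hc.ne'
    linarith
  · have e : kernelGramQ x₁ x₂ x₃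
        = 8 * ellSlopeMin ^ 2 + π ^ 2 * (-(16 * π) - ellSlopeMin) ^ 2
          + 16 * ellSlopeMin * (-(16 * π) - ellSlopeMin) := by
      have hq : π * (4 / π) = 4 := mul_div_cancel₀ 4 Real.pi_ne_zero
      rw [kernelGramQ, normSq_re_im, normSq_re_im, normSq_re_im]
      simp only [Complex.add_im, Complex.mul_im, Complex.conj_re, Complex.conj_im]
      rw [r1, i1, r2, i2, r3, i3]
      linear_combination (4 * ellSlopeMin * (-(16 * π) - ellSlopeMin)) * hq
    rw [e]
    nlinarith [sq_nonneg (ellSlopeMin + (-(16 * π) - ellSlopeMin)), mul_pos hd (pow_pos hu 2), Real.pi_pos]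

/-! ## C2b: the four closed-form control values -/

/-- **C2b**: `F_{21/20}(k₁) ∈ (−2.972, −2.9719)` (record `−2.97195`), `F_{21/20}(k₄) ∈ (29.934, 29.935)`
(`29.9347`), `F_{9/10}(k₄) ∈ (55.706, 55.707)` (`55.7067`), `F_{1/2}(k₄) ∈ (164.933, 164.934)` (`164.934`),
from the closed form `mainTermFormEll_afeDir`. [cite: Zhang2022LandauSiegel, §2 (2.10), (2.13)] -/
theorem controlEll_values :
    (mainTermFormEll (21/20) (afeDir 1) (afeDir' 1) ∈ Set.Ioo (-2.972 : ℝ) (-2.9719))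
    ∧ (mainTermFormEll (21/20) (afeDir 4) (afeDir' 4) ∈ Set.Ioo (29.934 : ℝ) 29.935)
    ∧ (mainTermFormEll (9/10) (afeDir 4) (afeDir' 4) ∈ Set.Ioo (55.706 : ℝ) 55.707)
    ∧ (mainTermFormEll (1/2) (afeDir 4) (afeDir' 4) ∈ Set.Ioo (164.933 : ℝ) 164.934) := by
  have h4 : (4:ℕ) ≠ 0 := by norm_num
  have lo := Real.pi_gt_d6
  have hi := Real.pi_lt_d6
  simp only [Set.mem_Ioo, mainTermFormEll_afeDir_one, mainTermFormEll_afeDir h4]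
  push_cast
  refine ⟨⟨?_, ?_⟩, ⟨?_, ?_⟩, ⟨?_, ?_⟩, ⟨?_, ?_⟩⟩ <;> nlinarith [lo, hi]

/-! ## C3b: the constrained slope `μ_c` of the length edge -/

/-- **`μ_c = −48π³/(3π²−16)`** — the nonzero generalized eigenvalue of the pencil
`(8π[[−1,1],[1,−1]], [[2, 1+4i/π],[1−4i/π, 2]])` = `(D_K, G_K)` restricted to the kernel plane
`K ∩ {u(1) = 0} = span{k₁+k₂, k₂+k₃}` (record `−109.3630472`, repair/num-1 L11 §3b kit j251370: the slope
`λ_min(θ) = μ_c(θ−1) + O((θ−1)²)` of the length edge). [cite: Zhang2022LandauSiegel, §7 Prop. 7.1, (7.2); §2 (2.13)] -/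
def lengthSlopeMin : ℝ := -(48 * π ^ 3) / (3 * π ^ 2 - 16)

/-- **`μ_c ∈ (−109.3631, −109.363)`**. [cite: Zhang2022LandauSiegel, §7 Prop. 7.1, (7.2); §2 (2.13)] -/
theorem lengthSlopeMin_bounds : (-109.3631 : ℝ) < lengthSlopeMin ∧ lengthSlopeMin < -109.363 := by
  have h2 := pi_sq_bounds
  have h3 := pi_cube_bounds
  have hd : 0 < 3 * π ^ 2 - 16 := by linarith [h2.1]
  unfold lengthSlopeMin
  constructor
  · rw [lt_div_iff₀ hd]; nlinarith [h2.1, h2.2, h3.1, h3.2]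
  · rw [div_lt_iff₀ hd]; nlinarith [h2.1, h2.2, h3.1, h3.2]

/-- The slope form on the kernel plane: `D_K(y₁(k₁+k₂) + y₂(k₂+k₃)) = ellSlopeQ y₁ (y₁+y₂) y₂ = −8π|y₁ − y₂|²`.
[cite: Zhang2022LandauSiegel, §7 Prop. 7.1, (7.2); §2 (2.13)] -/
theorem ellSlopeQ_plane (y₁ y₂ : ℂ) : ellSlopeQ y₁ (y₁ + y₂) y₂ = -(8 * π) * ‖y₁ - y₂‖ ^ 2 := by
  rw [ellSlopeQ_eq, normSq_re_im, normSq_re_im, normSq_re_im, normSq_re_im]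
  simp only [Complex.add_re, Complex.add_im, Complex.sub_re, Complex.sub_im]
  ring

/-- The Gram form on the kernel plane: `G_K(y₁(k₁+k₂) + y₂(k₂+k₃)) = 2|y₁|² + 2|y₂|² + 2Re(y₁ȳ₂) − (8/π)Im(y₁ȳ₂)`
(the matrix `[[2, 1+4i/π],[1−4i/π, 2]]` of the record). [cite: Zhang2022LandauSiegel, §7 Prop. 7.1, (7.2); §2 (2.13)] -/
theorem kernelGramQ_plane (y₁ y₂ : ℂ) : kernelGramQ y₁ (y₁ + y₂) y₂ =
    2 * ‖y₁‖ ^ 2 + 2 * ‖y₂‖ ^ 2 + 2 * (y₁ * conj y₂).re - 8 / π * (y₁ * conj y₂).im := by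
  rw [kernelGramQ]
  simp only [normSq_re_im, Complex.add_re, Complex.add_im, Complex.mul_re, Complex.mul_im, Complex.conj_re,
    Complex.conj_im, map_add]
  ring

/-- **The rank-one SOS identity at `μ_c`**: with `c = −8π − 2μ_c`,
`π²c·(D_K(y) − μ_c G_K(y)) = (πc·a₁ + π(8π−μ_c)·a₂ − 4μ_c·b₂)² + (πc·b₁ + π(8π−μ_c)·b₂ + 4μ_c·a₂)²`
(`y_k = a_k + ib_k`), by `(3π²−16)μ_c = −48π³`. [cite: Zhang2022LandauSiegel, §7 Prop. 7.1, (7.2); §2 (2.13)] -/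
theorem lengthSlopeQ_sos (y₁ y₂ : ℂ) :
    π ^ 2 * (-(8 * π) - 2 * lengthSlopeMin) *
        (ellSlopeQ y₁ (y₁ + y₂) y₂ - lengthSlopeMin * kernelGramQ y₁ (y₁ + y₂) y₂) =
      (π * (-(8 * π) - 2 * lengthSlopeMin) * y₁.re + π * (8 * π - lengthSlopeMin) * y₂.re
          - 4 * lengthSlopeMin * y₂.im) ^ 2
      + (π * (-(8 * π) - 2 * lengthSlopeMin) * y₁.im + π * (8 * π - lengthSlopeMin) * y₂.im
          + 4 * lengthSlopeMin * y₂.re) ^ 2 := by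
  have h2 := pi_sq_bounds
  have hd : 0 < 3 * π ^ 2 - 16 := by linarith [h2.1]
  have hπ : π ≠ 0 := Real.pi_ne_zero
  have hμ : (3 * π ^ 2 - 16) * lengthSlopeMin = -(48 * π ^ 3) := by
    unfold lengthSlopeMin; field_simp [hd.ne']
  have hq : π * (8 / π) = 8 := mul_div_cancel₀ 8 hπ
  rw [ellSlopeQ_plane, kernelGramQ_plane, normSq_re_im, normSq_re_im, normSq_re_im]
  simp only [Complex.sub_re, Complex.sub_im, Complex.mul_re, Complex.mul_im, Complex.conj_re, Complex.conj_im]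
  linear_combination (lengthSlopeMin * (y₂.re ^ 2 + y₂.im ^ 2)) * hμ
    + (π * (-(8 * π) - 2 * lengthSlopeMin) * lengthSlopeMin * (y₁.im * y₂.re - y₁.re * y₂.im)) * hq

/-- **`μ_c` is the minimum of the constrained pencil**: `μ_c·G_K(y) ≤ D_K(y)` on the kernel plane
(`c = −8π − 2μ_c > 0` and `lengthSlopeQ_sos`). [cite: Zhang2022LandauSiegel, §7 Prop. 7.1, (7.2); §2 (2.13)] -/
theorem lengthSlopeQ_ge (y₁ y₂ : ℂ) :
    lengthSlopeMin * kernelGramQ y₁ (y₁ + y₂) y₂ ≤ ellSlopeQ y₁ (y₁ + y₂) y₂ := by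
  have hb := lengthSlopeMin_bounds
  have hc : 0 < -(8 * π) - 2 * lengthSlopeMin := by nlinarith [Real.pi_lt_d6, hb.2]
  have hc2 : 0 < π ^ 2 * (-(8 * π) - 2 * lengthSlopeMin) := by positivity
  have h := lengthSlopeQ_sos y₁ y₂
  have hnn : 0 ≤ π ^ 2 * (-(8 * π) - 2 * lengthSlopeMin) *
      (ellSlopeQ y₁ (y₁ + y₂) y₂ - lengthSlopeMin * kernelGramQ y₁ (y₁ + y₂) y₂) := by
    rw [h]; positivity
  have := (mul_nonneg_iff_of_pos_left hc2).1 hnn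
  linarith

/-- **Both eigenvalues of the constrained pencil are attained**: the eigenvalue `0` at `y = (1, 1)` (`D_K = 0`
on `y₁ = y₂`), and `μ_c` at `y* = (π(8π−μ_c) + 4μ_c i, −πc)`, `c = −8π − 2μ_c`: `D_K(y*) = μ_c·G_K(y*)`. With
`lengthSlopeQ_ge`, `μ_c = min D_K/G_K` on the kernel plane. [cite: Zhang2022LandauSiegel, §7 Prop. 7.1, (7.2); §2 (2.13)] -/
theorem lengthSlopeQ_eigenvectors :
    ellSlopeQ (1:ℂ) (1 + 1) 1 = 0 ∧
    ellSlopeQ (((π * (8 * π - lengthSlopeMin) : ℝ) : ℂ) + ((4 * lengthSlopeMin : ℝ) : ℂ) * Complex.I)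
        ((((π * (8 * π - lengthSlopeMin) : ℝ) : ℂ) + ((4 * lengthSlopeMin : ℝ) : ℂ) * Complex.I)
          + (((-(π * (-(8 * π) - 2 * lengthSlopeMin))) : ℝ) : ℂ))
        ((((-(π * (-(8 * π) - 2 * lengthSlopeMin))) : ℝ) : ℂ))
      = lengthSlopeMin * kernelGramQ
        (((π * (8 * π - lengthSlopeMin) : ℝ) : ℂ) + ((4 * lengthSlopeMin : ℝ) : ℂ) * Complex.I)
        ((((π * (8 * π - lengthSlopeMin) : ℝ) : ℂ) + ((4 * lengthSlopeMin : ℝ) : ℂ) * Complex.I)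
          + (((-(π * (-(8 * π) - 2 * lengthSlopeMin))) : ℝ) : ℂ))
        ((((-(π * (-(8 * π) - 2 * lengthSlopeMin))) : ℝ) : ℂ)) := by
  have hb := lengthSlopeMin_bounds
  have hc : 0 < -(8 * π) - 2 * lengthSlopeMin := by nlinarith [Real.pi_lt_d6, hb.2]
  have hc2 : 0 < π ^ 2 * (-(8 * π) - 2 * lengthSlopeMin) := by positivity
  constructor
  · rw [ellSlopeQ_plane]; simp
  · set y₁ : ℂ := ((π * (8 * π - lengthSlopeMin) : ℝ) : ℂ) + ((4 * lengthSlopeMin : ℝ) : ℂ) * Complex.I with hy₁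
    set y₂ : ℂ := (((-(π * (-(8 * π) - 2 * lengthSlopeMin))) : ℝ) : ℂ) with hy₂
    have r1 : y₁.re = π * (8 * π - lengthSlopeMin) := by rw [hy₁]; simp
    have i1 : y₁.im = 4 * lengthSlopeMin := by rw [hy₁]; simp
    have r2 : y₂.re = -(π * (-(8 * π) - 2 * lengthSlopeMin)) := by rw [hy₂]; simp
    have i2 : y₂.im = 0 := by rw [hy₂]; simp
    have h := lengthSlopeQ_sos y₁ y₂
    rw [r1, i1, r2, i2] at h
    have hz : π ^ 2 * (-(8 * π) - 2 * lengthSlopeMin) *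
        (ellSlopeQ y₁ (y₁ + y₂) y₂ - lengthSlopeMin * kernelGramQ y₁ (y₁ + y₂) y₂) = 0 := by
      rw [h]; ring
    have := (mul_eq_zero.1 hz).resolve_left hc2.ne'
    linarith

end Objective

end Literature.NumberTheory.LFunctions.Zhang2022
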